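import Summits.CriticalPhenomena.PercolationContinuityZ3.Theorems.PercNearOneGluingNoHeavyLowerTailIncStarBranchLemmaStep
import HarnessLib

/-!
# The two-target branch lemma `Θ′ ≥ 0`, I: the bridge step with one target behind the bridge

Support file for the Sahi programme (`--supports stmt-CriticalPhenomena-4575`, prover prim-sahi-p2 gen 19).  No definitions, no named
facts, no sorries; standard axioms.  Memo `prim-sahi-p2/PROOF-E3.md` (29l)–(29m).

For a root `s`, a port `v` and targets `b, c` put (`P = prodBernoulli w`, root-connection form)
`Θ′(w; v; b, c) = Ξ_b + Ξ_c + D_bc − ½(D_b·m_c + D_c·m_b) − D_b·D_c`, `D_t = P(t↔v ∧ v↮s)`, `D_bc = P(b↔v ∧ c↔v ∧ v↮s)`,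
`Ξ_b = P(b↔v ∧ v↮s ∧ s↔c)`, `Ξ_c = P(c↔v ∧ v↮s ∧ s↔b)`, `m_t = P(s↔t)`.  THEOREM Θ′ (`IncStar.theta_nonneg`, file `…IncStarThetaTree`):
`Θ′ ≥ 0` at every port of every apex-forest.  It is the two-target input of the same-branch step of the R-side lemma of THEOREM C½
(PROOF-E3 (29l): `RS = pA′{pA′RS₁ + σ₀Θ₁ + pD₁bD₁c[3A′σ₁(1−p) − σ₀]}`, `Θ = Θ′ + D_bD_c`).

Here: `b` (with `x₁`) lies in the near side `L ∌ s` of the environment bridge `e₁ = s(x₁, v)` and `c ∉ L`.  Conditioning on `e₁` with the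
machinery of `…IncStarBridgeEvents` gives (`IncStar.theta_diffBranch_real`, by `ring`)
`Θ′ = ½pD₁b·Br_c + d_c{½m_b(1−p) + p(H₁b − ½A₁m_b)} + ½p²σ₁D₁b·d_c`, nonnegative by the branch lemma at `(w[e₁↦0]; v, c)` (`Br_c ≥ 0`),
the branch lemma at `(w[e₁↦0]; x₁, b)` (`2H₁b − A₁m_b ≥ −σ₁D₁b`) and Harris (`m_b ≥ σ₁D₁b`).  Exact brute force: gen19 `theta_ident.py` (identity
120/120), `psi_check.py` (`Θ′ ≥ 0`, 0/1050 on forests).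
-/


noncomputable section

namespace Summit.CriticalPhenomena.PercolationContinuityZ3.Theorems

namespace IncStar

open MeasureTheory Set Literature.Probability.Percolation Literature.Probability.LatticeModels EdgeInduction
open scoped Classical

variable {n : ℕ}

/-- **Arithmetic of the bridge step of `Θ′` with one target behind the bridge.**  Near quantities `A₁, Db = D₁b, Hb = H₁b, mb`;
far quantities `A′, dc, gc, mc` (port `v`, target `c`, under `w[e₁↦0]`). [this work] -/
theorem theta_diffBranch_real (p A' A₁ Db Hb mb dc gc mc : ℝ) (hp0 : 0 ≤ p) (hp1 : p ≤ 1) (hA₁1 : A₁ ≤ 1) (hDb : 0 ≤ Db) (hdc : 0 ≤ dc)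
    (BrNear : A₁ * (mb + Db) ≤ Db + 2 * Hb) (BrFar : A' * (mc + dc) ≤ dc + 2 * gc) (HarB : (1 - A₁) * Db ≤ mb) :
    0 ≤ ((1 - p) * 0 + p * (Db * gc))
        + ((1 - p) * (mb * dc) + p * (Hb * dc)) + ((1 - p) * 0 + p * (Db * dc))
        - 1 / 2 * (((1 - p) * 0 + p * (Db * A')) * ((1 - p) * mc + p * (mc + (1 - A₁) * dc))
            + ((1 - p) * dc + p * (A₁ * dc)) * ((1 - p) * mb + p * (mb + Db * (1 - A'))))
        - ((1 - p) * 0 + p * (Db * A')) * ((1 - p) * dc + p * (A₁ * dc)) := by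
  have key : ((1 - p) * 0 + p * (Db * gc))
        + ((1 - p) * (mb * dc) + p * (Hb * dc)) + ((1 - p) * 0 + p * (Db * dc))
        - 1 / 2 * (((1 - p) * 0 + p * (Db * A')) * ((1 - p) * mc + p * (mc + (1 - A₁) * dc))
            + ((1 - p) * dc + p * (A₁ * dc)) * ((1 - p) * mb + p * (mb + Db * (1 - A'))))
        - ((1 - p) * 0 + p * (Db * A')) * ((1 - p) * dc + p * (A₁ * dc))
      = 1 / 2 * p * Db * (dc + 2 * gc - A' * (mc + dc))
        + dc * (p * (Hb - 1 / 2 * A₁ * mb) + 1 / 2 * ((1 - p) * mb) + 1 / 2 * (p ^ 2 * ((1 - A₁) * Db))) := by ring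
  rw [key]
  have h1 : 0 ≤ 1 / 2 * p * Db * (dc + 2 * gc - A' * (mc + dc)) :=
    mul_nonneg (mul_nonneg (mul_nonneg (by norm_num) hp0) hDb) (by linarith)
  have e1 : A₁ * (mb + Db) = A₁ * mb + A₁ * Db := by ring
  have e2 : (1 - A₁) * Db = Db - A₁ * Db := by ring
  have h2 : -(1 / 2) * ((1 - A₁) * Db) ≤ Hb - 1 / 2 * A₁ * mb := by linarith
  have h3 : 0 ≤ (1 - A₁) * Db := mul_nonneg (by linarith) hDb
  have h4 : p * (-(1 / 2) * ((1 - A₁) * Db)) ≤ p * (Hb - 1 / 2 * A₁ * mb) := mul_le_mul_of_nonneg_left h2 hp0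
  have h5a : p * ((1 - A₁) * Db) ≤ (1 - A₁) * Db := mul_le_of_le_one_left h3 hp1
  have h5 : 0 ≤ (1 - p) * (mb - p * ((1 - A₁) * Db)) := mul_nonneg (by linarith) (by linarith)
  have h6 : 0 ≤ p * (Hb - 1 / 2 * A₁ * mb) + 1 / 2 * ((1 - p) * mb) + 1 / 2 * (p ^ 2 * ((1 - A₁) * Db)) := by
    have e3 : p * (-(1 / 2) * ((1 - A₁) * Db)) + 1 / 2 * ((1 - p) * mb) + 1 / 2 * (p ^ 2 * ((1 - A₁) * Db))
        = 1 / 2 * ((1 - p) * (mb - p * ((1 - A₁) * Db))) := by ring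
    linarith [h4, h5, e3]
  have h7 : 0 ≤ dc * (p * (Hb - 1 / 2 * A₁ * mb) + 1 / 2 * ((1 - p) * mb) + 1 / 2 * (p ^ 2 * ((1 - A₁) * Db))) :=
    mul_nonneg hdc h6
  exact add_nonneg h1 h7

/-- **`Θ′`, the bridge step with `b` behind the bridge and `c` not** (covers 'different branches' and '`c` outside the tree'). [this work] -/
theorem theta_bridge_step_diffBranch (w : Sym2 (Fin n) → unitInterval) (L : Set (Fin n)) {s x₁ v b c : Fin n}
    (hsL : s ∉ L) (hxL : x₁ ∈ L) (hvL : v ∉ L) (hbL : b ∈ L) (hcL : c ∉ L)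
    (hcross : ∀ x y : Fin n, x ∈ L → y ∉ L → y ≠ s → s(x, y) ≠ s(x₁, v) → w s(x, y) = 0)
    (BrNear : (prodBernoulli (Function.update w s(x₁, v) 0)).real (openConn s x₁)ᶜ * (prodBernoulli (Function.update w s(x₁, v) 0)).real (openConn b x₁ ∪ openConn s b)
        ≤ (prodBernoulli (Function.update w s(x₁, v) 0)).real (openConn b x₁ \ openConn s x₁) + 2 * (prodBernoulli (Function.update w s(x₁, v) 0)).real ((openConn s x₁)ᶜ ∩ (openConn b x₁)ᶜ ∩ openConn s b))
    (BrFar : (prodBernoulli (Function.update w s(x₁, v) 0)).real (openConn s v)ᶜ * (prodBernoulli (Function.update w s(x₁, v) 0)).real (openConn c v ∪ openConn s c)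
        ≤ (prodBernoulli (Function.update w s(x₁, v) 0)).real (openConn c v \ openConn s v) + 2 * (prodBernoulli (Function.update w s(x₁, v) 0)).real ((openConn s v)ᶜ ∩ (openConn c v)ᶜ ∩ openConn s c)) :
    0 ≤ (prodBernoulli w).real ((openConn b v \ openConn s v) ∩ openConn s c)
        + (prodBernoulli w).real ((openConn c v \ openConn s v) ∩ openConn s b) + (prodBernoulli w).real ((openConn b v ∩ openConn c v) \ openConn s v)
        - 1 / 2 * ((prodBernoulli w).real (openConn b v \ openConn s v) * (prodBernoulli w).real (openConn s c)
            + (prodBernoulli w).real (openConn c v \ openConn s v) * (prodBernoulli w).real (openConn s b))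
        - (prodBernoulli w).real (openConn b v \ openConn s v) * (prodBernoulli w).real (openConn c v \ openConn s v) := by
  -- names
  set e : Sym2 (Fin n) := s(x₁, v)
  set w0 := Function.update w e 0 with hw0
  set w1 := Function.update w e 1
  have hs1 : s ∈ insert s L := Set.mem_insert s L
  have hx1 : x₁ ∈ insert s L := Set.mem_insert_of_mem s hxL
  have hb1 : b ∈ insert s L := Set.mem_insert_of_mem s hbL
  set S : Set (BondConfig (Fin n)) := openConnIn (insert s L) s x₁
  set Bn : Set (BondConfig (Fin n)) := openConnIn (insert s L) s b
  set Fb : Set (BondConfig (Fin n)) := openConnIn (insert s L) b x₁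
  set W' : Set (BondConfig (Fin n)) := openConnIn Lᶜ s v
  set Cf : Set (BondConfig (Fin n)) := openConnIn Lᶜ s c
  set Rc : Set (BondConfig (Fin n)) := openConnIn Lᶜ c v
  -- (0) the bridge hypothesis under `w0`, the almost-sure set, independence
  have hw0cross : ∀ x y : Fin n, x ∈ L → y ∉ L → y ≠ s → w0 s(x, y) = 0 := by
    intro x y hx hy hys
    by_cases hxy : s(x, y) = e
    · rw [hxy, hw0, Function.update_self]
    · rw [hw0, Function.update_of_ne hxy]; exact hcross x y hx hy hys hxy
  set G : Set (BondConfig (Fin n)) := {ω | ∀ e', w0 e' = 0 → e' ∉ ω}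
  have hG1 : (prodBernoulli w0).real G = 1 := real_sureClosed w0
  have hωG : ∀ ω ∈ G, ∀ x y : Fin n, x ∈ L → y ∉ L → y ≠ s → s(x, y) ∉ ω :=
    fun ω hω x y hx hy hys => hω _ (hw0cross x y hx hy hys)
  have hm : ∀ X : Set (BondConfig (Fin n)), MeasurableSet X := fun _ => MeasurableSet.of_discrete
  have hdiff : ∀ {A B : Set (BondConfig (Fin n))} {K' : Set (Sym2 (Fin n))},
      DeterminedBy A K' → DeterminedBy B K' → DeterminedBy (A \ B) K' := by
    intro A B K' hA hB
    rw [determinedBy_iff] at hA hB ⊢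
    intro ω ω' h
    rw [Set.mem_sdiff, Set.mem_sdiff, hA ω ω' h, hB ω ω' h]
  have hdn : ∀ x y : Fin n, DeterminedBy (openConnIn (insert s L) x y : Set (BondConfig (Fin n)))
      {z : Sym2 (Fin n) | ¬ z.IsDiag ∧ ∀ x ∈ z, x ∈ insert s L} := fun x y => IncStarCutVertex.determinedBy_openConnIn_offDiag _ x y
  have hdf : ∀ x y : Fin n, DeterminedBy (openConnIn Lᶜ x y : Set (BondConfig (Fin n)))
      {z : Sym2 (Fin n) | ¬ z.IsDiag ∧ ∀ x ∈ z, x ∈ Lᶜ} := fun x y => IncStarCutVertex.determinedBy_openConnIn_offDiag _ x y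
  have hdW'c : DeterminedBy (Set.univ \ W') {z : Sym2 (Fin n) | ¬ z.IsDiag ∧ ∀ x ∈ z, x ∈ Lᶜ} := hdiff (determinedBy_univ _) (hdf s v)
  have hdSc : DeterminedBy (Set.univ \ S) {z : Sym2 (Fin n) | ¬ z.IsDiag ∧ ∀ x ∈ z, x ∈ insert s L} := hdiff (determinedBy_univ _) (hdn s x₁)
  have indep : ∀ {A B : Set (BondConfig (Fin n))}, DeterminedBy A {z : Sym2 (Fin n) | ¬ z.IsDiag ∧ ∀ x ∈ z, x ∈ insert s L} →
      DeterminedBy B {z : Sym2 (Fin n) | ¬ z.IsDiag ∧ ∀ x ∈ z, x ∈ Lᶜ} →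
      (prodBernoulli w0).real (A ∩ B) = (prodBernoulli w0).real A * (prodBernoulli w0).real B :=
    fun hA hB => indep_blocks w0 L s hA hB
  have hBFS : ∀ ω, ω ∈ Bn → ω ∈ Fb → ω ∈ S := fun ω hB hF => PlanarDuality.openConnIn_trans hB hF
  have hFSB : ∀ ω, ω ∈ Fb → ω ∈ S → ω ∈ Bn := fun ω hF hS => PlanarDuality.openConnIn_trans hS (openConnIn_symm' hF)
  have hCRW : ∀ ω, ω ∈ Cf → ω ∈ Rc → ω ∈ W' := fun ω hC hR => PlanarDuality.openConnIn_trans hC hR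
  have hRWC : ∀ ω, ω ∈ Rc → ω ∈ W' → ω ∈ Cf := fun ω hR hW => PlanarDuality.openConnIn_trans hW (openConnIn_symm' hR)
  -- (1) dictionary on the sure set
  have c_sv : ∀ ω ∈ G, (ω ∈ openConn s v ↔ ω ∈ W') := fun ω hω => by
    rw [bridge_conn_lr L hsL (hωG ω hω) hs1 hvL]
    exact ⟨fun h => h.2, fun h => ⟨⟨hs1, hs1, SimpleGraph.Reachable.refl _⟩, h⟩⟩
  have c_sb : ∀ ω ∈ G, (ω ∈ openConn s b ↔ ω ∈ Bn) := fun ω hω => bridge_conn_ll L hsL (hωG ω hω) hs1 hb1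
  have c_sc : ∀ ω ∈ G, (ω ∈ openConn s c ↔ ω ∈ Cf) := fun ω hω => by
    rw [bridge_conn_lr L hsL (hωG ω hω) hs1 hcL]
    exact ⟨fun h => h.2, fun h => ⟨⟨hs1, hs1, SimpleGraph.Reachable.refl _⟩, h⟩⟩
  have c_bv : ∀ ω ∈ G, (ω ∈ openConn b v ↔ ω ∈ Bn ∧ ω ∈ W') := fun ω hω => by
    rw [bridge_conn_lr L hsL (hωG ω hω) hb1 hvL]
    exact ⟨fun h => ⟨openConnIn_symm' h.1, h.2⟩, fun h => ⟨openConnIn_symm' h.1, h.2⟩⟩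
  have c_cv : ∀ ω ∈ G, (ω ∈ openConn c v ↔ ω ∈ Rc) := fun ω hω => bridge_conn_rr L hsL (hωG ω hω) hcL hvL
  have c_bx : ∀ ω ∈ G, (ω ∈ openConn b x₁ ↔ ω ∈ Fb) := fun ω hω => bridge_conn_ll L hsL (hωG ω hω) hb1 hx1
  have c_cx : ∀ ω ∈ G, (ω ∈ openConn c x₁ ↔ ω ∈ Cf ∧ ω ∈ S) := fun ω hω => by
    rw [bridge_conn_rl L hsL (hωG ω hω) hcL hx1]
    exact ⟨fun h => ⟨openConnIn_symm' h.1, h.2⟩, fun h => ⟨openConnIn_symm' h.1, h.2⟩⟩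
  have c_sx : ∀ ω ∈ G, (ω ∈ openConn s x₁ ↔ ω ∈ S) := fun ω hω => bridge_conn_ll L hsL (hωG ω hω) hs1 hx1
  -- (2) lifted events
  have l_sv : ∀ ω ∈ G, (insert e ω ∈ openConn s v ↔ ω ∈ W' ∨ ω ∈ S) := fun ω hω => by
    rw [bridge_lift_far L hsL hxL hvL hvL (hωG ω hω)]
    have hvv : ω ∈ openConnIn Lᶜ v v := ⟨hvL, hvL, SimpleGraph.Reachable.refl _⟩
    exact ⟨fun h => h.imp id fun h' => h'.1, fun h => h.imp id fun h' => ⟨h', hvv⟩⟩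
  have l_sb : ∀ ω ∈ G, (insert e ω ∈ openConn s b ↔ ω ∈ Bn ∨ (ω ∈ W' ∧ ω ∈ Fb)) := fun ω hω => by
    rw [bridge_lift_near L hsL hxL hvL hbL (hωG ω hω)]
    exact ⟨fun h => h.imp id fun h' => ⟨h'.1, openConnIn_symm' h'.2⟩, fun h => h.imp id fun h' => ⟨h'.1, openConnIn_symm' h'.2⟩⟩
  have l_sc : ∀ ω ∈ G, (insert e ω ∈ openConn s c ↔ ω ∈ Cf ∨ (ω ∈ S ∧ ω ∈ Rc)) := fun ω hω => by
    rw [bridge_lift_far L hsL hxL hvL hcL (hωG ω hω)]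
    exact ⟨fun h => h.imp id fun h' => ⟨h'.1, openConnIn_symm' h'.2⟩, fun h => h.imp id fun h' => ⟨h'.1, openConnIn_symm' h'.2⟩⟩
  have l_bv : ∀ ω ∈ G, (insert e ω ∈ openConn b v ↔ (ω ∈ Bn ∧ ω ∈ W') ∨ ω ∈ Fb) := fun ω hω => by
    rw [insert_pair_mem_openConn_iff, c_bv ω hω, c_bx ω hω]
    have hvv : ω ∈ openConn v v := SimpleGraph.Reachable.refl _
    constructor
    · rintro (h | ⟨h1, -⟩)
      · exact Or.inl h
      · exact h1.symm
    · rintro (h | h)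
      · exact Or.inl h
      · exact Or.inr ⟨Or.inl h, Or.inr hvv⟩
  have l_cv : ∀ ω ∈ G, (insert e ω ∈ openConn c v ↔ ω ∈ Rc ∨ (ω ∈ Cf ∧ ω ∈ S)) := fun ω hω => by
    rw [insert_pair_mem_openConn_iff, c_cv ω hω, c_cx ω hω]
    have hvv : ω ∈ openConn v v := SimpleGraph.Reachable.refl _
    constructor
    · rintro (h | ⟨h1, -⟩)
      · exact Or.inl h
      · exact h1.symm
    · rintro (h | h)
      · exact Or.inl h
      · exact Or.inr ⟨Or.inl h, Or.inr hvv⟩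
  -- (3) one-bond decomposition and the lift
  have ob : ∀ A : Set (BondConfig (Fin n)),
      (prodBernoulli w).real A = (1 - (w e : ℝ)) * (prodBernoulli w0).real A + (w e : ℝ) * (prodBernoulli w1).real A := by
    intro A
    have hA : DeterminedBy A (↑(Finset.univ : Finset (Sym2 (Fin n))) : Set (Sym2 (Fin n))) := by
      rw [determinedBy_iff]
      intro ω ω' h
      rw [Finset.coe_univ, Set.inter_univ, Set.inter_univ] at h
      rw [h]
    exact prodBernoulli_real_oneBond hA w (Finset.mem_univ e)
  have lift : ∀ A : Set (BondConfig (Fin n)),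
      (prodBernoulli w1).real A = (prodBernoulli w0).real ((fun ω : BondConfig (Fin n) => insert e ω) ⁻¹' A) :=
    fun A => tieLiftOne_real_one_eq w e A
  have zero_of_empty : ∀ {A : Set (BondConfig (Fin n))}, (∀ ω ∈ G, ω ∉ A) → (prodBernoulli w0).real A = 0 := by
    intro A hA
    have h : (prodBernoulli w0).real A = (prodBernoulli w0).real (∅ : Set (BondConfig (Fin n))) :=
      real_congr_of_sure hG1 fun ω hω => ⟨fun h => (hA ω hω h).elim, fun h => (Set.notMem_empty _ h).elim⟩
    rw [h, measureReal_empty]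
  -- complements and splits
  have hW'c : (prodBernoulli w0).real W' = 1 - (prodBernoulli w0).real (Set.univ \ W') := by
    rw [← Set.compl_eq_univ_sdiff, probReal_compl_eq_one_sub (hm _)]; ring
  have hSc : (prodBernoulli w0).real S = 1 - (prodBernoulli w0).real (Set.univ \ S) := by
    rw [← Set.compl_eq_univ_sdiff, probReal_compl_eq_one_sub (hm _)]; ring
  have hfb : (Fb \ Bn : Set (BondConfig (Fin n))) = Fb \ S := by
    ext ω; simp only [Set.mem_sdiff]
    exact ⟨fun h => ⟨h.1, fun hS => h.2 (hFSB ω h.1 hS)⟩, fun h => ⟨h.1, fun hB => h.2 (hBFS ω hB h.1)⟩⟩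
  have hrc : (Rc \ Cf : Set (BondConfig (Fin n))) = Rc \ W' := by
    ext ω; simp only [Set.mem_sdiff]
    exact ⟨fun h => ⟨h.1, fun hW => h.2 (hRWC ω h.1 hW)⟩, fun h => ⟨h.1, fun hC => h.2 (hCRW ω hC h.1)⟩⟩
  have hz : (prodBernoulli w0).real (Rc ∪ Cf) = (prodBernoulli w0).real Cf + (prodBernoulli w0).real (Rc \ W') := by
    rw [← hrc, Set.union_comm, ← measureReal_union Set.disjoint_sdiff_right (hm _), Set.union_sdiff_self]
  -- (4) moments under `w0`
  have a0 : (prodBernoulli w0).real (openConn s v)ᶜ = (prodBernoulli w0).real (Set.univ \ W') :=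
    real_congr_of_sure hG1 fun ω hω => by
      rw [Set.mem_compl_iff, c_sv ω hω, Set.mem_sdiff]; exact ⟨fun h => ⟨Set.mem_univ _, h⟩, fun h => h.2⟩
  have db0 : (prodBernoulli w0).real (openConn b v \ openConn s v) = 0 :=
    zero_of_empty fun ω hω h => by rw [Set.mem_sdiff, c_bv ω hω, c_sv ω hω] at h; exact h.2 h.1.2
  have dc0 : (prodBernoulli w0).real (openConn c v \ openConn s v) = (prodBernoulli w0).real (Rc \ W') :=
    real_congr_of_sure hG1 fun ω hω => by rw [Set.mem_sdiff, Set.mem_sdiff, c_cv ω hω, c_sv ω hω]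
  have dbc0 : (prodBernoulli w0).real ((openConn b v ∩ openConn c v) \ openConn s v) = 0 :=
    zero_of_empty fun ω hω h => by
      rw [Set.mem_sdiff, Set.mem_inter_iff, c_bv ω hω, c_sv ω hω] at h; exact h.2 h.1.1.2
  have xb0 : (prodBernoulli w0).real ((openConn b v \ openConn s v) ∩ openConn s c) = 0 :=
    zero_of_empty fun ω hω h => by
      rw [Set.mem_inter_iff, Set.mem_sdiff, c_bv ω hω, c_sv ω hω] at h; exact h.1.2 h.1.1.2
  have xc0 : (prodBernoulli w0).real ((openConn c v \ openConn s v) ∩ openConn s b)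
      = (prodBernoulli w0).real Bn * (prodBernoulli w0).real (Rc \ W') := by
    rw [← indep (hdn s b) (hdiff (hdf c v) (hdf s v))]
    refine real_congr_of_sure hG1 fun ω hω => ?_
    simp only [Set.mem_inter_iff, Set.mem_sdiff, c_cv ω hω, c_sv ω hω, c_sb ω hω]
    tauto
  have hc0 : (prodBernoulli w0).real ((openConn s v)ᶜ ∩ (openConn c v)ᶜ ∩ openConn s c) = (prodBernoulli w0).real (Cf \ W') :=
    real_congr_of_sure hG1 fun ω hω => by
      simp only [Set.mem_inter_iff, Set.mem_compl_iff, Set.mem_sdiff, c_sv ω hω, c_cv ω hω, c_sc ω hω]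
      exact ⟨fun h => ⟨h.2, h.1.1⟩, fun h => ⟨⟨h.2, fun hR => h.2 (hCRW ω h.1 hR)⟩, h.1⟩⟩
  have zc0 : (prodBernoulli w0).real (openConn c v ∪ openConn s c) = (prodBernoulli w0).real (Rc ∪ Cf) :=
    real_congr_of_sure hG1 fun ω hω => by rw [Set.mem_union, Set.mem_union, c_cv ω hω, c_sc ω hω]
  have mb0 : (prodBernoulli w0).real (openConn s b) = (prodBernoulli w0).real Bn := real_congr_of_sure hG1 c_sb
  have mc0 : (prodBernoulli w0).real (openConn s c) = (prodBernoulli w0).real Cf := real_congr_of_sure hG1 c_sc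
  -- (5) moments under `w1`
  have db1 : (prodBernoulli w1).real (openConn b v \ openConn s v)
      = (prodBernoulli w0).real (Fb \ S) * (prodBernoulli w0).real (Set.univ \ W') := by
    rw [lift, ← indep (hdiff (hdn b x₁) (hdn s x₁)) hdW'c]
    refine real_congr_of_sure hG1 fun ω hω => ?_
    simp only [Set.preimage_sdiff, Set.mem_sdiff, Set.mem_preimage, l_bv ω hω, l_sv ω hω, Set.mem_inter_iff, Set.mem_univ, true_and]
    tauto
  have dc1 : (prodBernoulli w1).real (openConn c v \ openConn s v)
      = (prodBernoulli w0).real (Set.univ \ S) * (prodBernoulli w0).real (Rc \ W') := by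
    rw [lift, ← indep hdSc (hdiff (hdf c v) (hdf s v))]
    refine real_congr_of_sure hG1 fun ω hω => ?_
    simp only [Set.preimage_sdiff, Set.mem_sdiff, Set.mem_preimage, l_cv ω hω, l_sv ω hω, Set.mem_inter_iff, Set.mem_univ, true_and]
    tauto
  have dbc1 : (prodBernoulli w1).real ((openConn b v ∩ openConn c v) \ openConn s v)
      = (prodBernoulli w0).real (Fb \ S) * (prodBernoulli w0).real (Rc \ W') := by
    rw [lift, ← indep (hdiff (hdn b x₁) (hdn s x₁)) (hdiff (hdf c v) (hdf s v))]
    refine real_congr_of_sure hG1 fun ω hω => ?_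
    simp only [Set.preimage_sdiff, Set.preimage_inter, Set.mem_sdiff, Set.mem_inter_iff, Set.mem_preimage, l_bv ω hω, l_cv ω hω, l_sv ω hω]
    tauto
  have xb1 : (prodBernoulli w1).real ((openConn b v \ openConn s v) ∩ openConn s c)
      = (prodBernoulli w0).real (Fb \ S) * (prodBernoulli w0).real (Cf \ W') := by
    rw [lift, ← indep (hdiff (hdn b x₁) (hdn s x₁)) (hdiff (hdf s c) (hdf s v))]
    refine real_congr_of_sure hG1 fun ω hω => ?_
    simp only [Set.preimage_sdiff, Set.preimage_inter, Set.mem_sdiff, Set.mem_inter_iff, Set.mem_preimage, l_bv ω hω, l_sc ω hω, l_sv ω hω, not_or]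
    constructor
    · rintro ⟨⟨hbv, hW, hS⟩, hc⟩
      have hF : ω ∈ Fb := hbv.resolve_left fun h => hW h.2
      exact ⟨⟨hF, hS⟩, hc.resolve_right fun h => hS h.1, hW⟩
    · rintro ⟨⟨hF, hS⟩, hC, hW⟩
      exact ⟨⟨Or.inr hF, hW, hS⟩, Or.inl hC⟩
  have xc1 : (prodBernoulli w1).real ((openConn c v \ openConn s v) ∩ openConn s b)
      = (prodBernoulli w0).real ((Bn \ S) \ Fb) * (prodBernoulli w0).real (Rc \ W') := by
    rw [lift, ← indep (hdiff (hdiff (hdn s b) (hdn s x₁)) (hdn b x₁)) (hdiff (hdf c v) (hdf s v))]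
    refine real_congr_of_sure hG1 fun ω hω => ?_
    simp only [Set.preimage_sdiff, Set.preimage_inter, Set.mem_sdiff, Set.mem_inter_iff, Set.mem_preimage, l_cv ω hω, l_sb ω hω, l_sv ω hω, not_or]
    constructor
    · rintro ⟨⟨hcv, hW, hS⟩, hb⟩
      have hR : ω ∈ Rc := hcv.resolve_right fun h => hS h.2
      have hB : ω ∈ Bn := hb.resolve_right fun h => hW h.1
      exact ⟨⟨⟨hB, hS⟩, fun hF => hS (hBFS ω hB hF)⟩, hR, hW⟩
    · rintro ⟨⟨⟨hB, hS⟩, -⟩, hR, hW⟩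
      exact ⟨⟨Or.inl hR, hW, hS⟩, Or.inl hB⟩
  have mb1 : (prodBernoulli w1).real (openConn s b) = (prodBernoulli w0).real Bn + (prodBernoulli w0).real (Fb \ S) * (prodBernoulli w0).real W' := by
    rw [lift, ← indep (hdiff (hdn b x₁) (hdn s x₁)) (hdf s v), ← measureReal_union ?_ (hm _)]
    · refine real_congr_of_sure hG1 fun ω hω => ?_
      simp only [Set.mem_preimage, l_sb ω hω, Set.mem_union, Set.mem_inter_iff, Set.mem_sdiff]
      constructor
      · rintro (hB | ⟨hW, hF⟩)
        · exact Or.inl hB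
        · by_cases hB : ω ∈ Bn
          · exact Or.inl hB
          · exact Or.inr ⟨⟨hF, fun hS => hB (hFSB ω hF hS)⟩, hW⟩
      · rintro (hB | ⟨⟨hF, -⟩, hW⟩)
        · exact Or.inl hB
        · exact Or.inr ⟨hW, hF⟩
    · exact Set.disjoint_left.2 fun ω hB h2 => h2.1.2 (hBFS ω hB h2.1.1)
  have mc1 : (prodBernoulli w1).real (openConn s c) = (prodBernoulli w0).real Cf + (prodBernoulli w0).real S * (prodBernoulli w0).real (Rc \ W') := by
    rw [lift, ← indep (hdn s x₁) (hdiff (hdf c v) (hdf s v)), ← measureReal_union ?_ (hm _)]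
    · refine real_congr_of_sure hG1 fun ω hω => ?_
      simp only [Set.mem_preimage, l_sc ω hω, Set.mem_union, Set.mem_inter_iff, Set.mem_sdiff]
      constructor
      · rintro (hC | ⟨hS, hR⟩)
        · exact Or.inl hC
        · by_cases hW : ω ∈ W'
          · exact Or.inl (hRWC ω hR hW)
          · exact Or.inr ⟨hS, hR, hW⟩
      · rintro (hC | ⟨hS, hR, -⟩)
        · exact Or.inl hC
        · exact Or.inr ⟨hS, hR⟩
    · exact Set.disjoint_left.2 fun ω hC h2 => h2.2.2 (hCRW ω hC h2.2.1)
  -- the branch lemmas and Harris in block form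
  have eA₁ : (prodBernoulli w0).real (openConn s x₁)ᶜ = (prodBernoulli w0).real (Set.univ \ S) :=
    real_congr_of_sure hG1 fun ω hω => by
      rw [Set.mem_compl_iff, c_sx ω hω, Set.mem_sdiff]; exact ⟨fun h => ⟨Set.mem_univ _, h⟩, fun h => h.2⟩
  have eDb : (prodBernoulli w0).real (openConn b x₁ \ openConn s x₁) = (prodBernoulli w0).real (Fb \ S) :=
    real_congr_of_sure hG1 fun ω hω => by rw [Set.mem_sdiff, Set.mem_sdiff, c_bx ω hω, c_sx ω hω]
  have eHb : (prodBernoulli w0).real ((openConn s x₁)ᶜ ∩ (openConn b x₁)ᶜ ∩ openConn s b)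
      = (prodBernoulli w0).real ((Bn \ S) \ Fb) :=
    real_congr_of_sure hG1 fun ω hω => by
      simp only [Set.mem_inter_iff, Set.mem_compl_iff, c_sx ω hω, c_bx ω hω, c_sb ω hω, Set.mem_sdiff]; tauto
  have eZb : (prodBernoulli w0).real (openConn b x₁ ∪ openConn s b) = (prodBernoulli w0).real Bn + (prodBernoulli w0).real (Fb \ S) := by
    rw [← measureReal_union ?_ (hm _)]
    · refine real_congr_of_sure hG1 fun ω hω => ?_
      rw [Set.mem_union, Set.mem_union, c_bx ω hω, c_sb ω hω, Set.mem_sdiff]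
      constructor
      · rintro (hF | hB)
        · by_cases hB : ω ∈ Bn
          · exact Or.inl hB
          · exact Or.inr ⟨hF, fun hS => hB (hFSB ω hF hS)⟩
        · exact Or.inl hB
      · rintro (hB | ⟨hF, -⟩)
        · exact Or.inr hB
        · exact Or.inl hF
    · exact Set.disjoint_left.2 fun ω hB h2 => h2.2 (hBFS ω hB h2.1)
  have HarB : (1 - (prodBernoulli w0).real (Set.univ \ S)) * (prodBernoulli w0).real (Fb \ S) ≤ (prodBernoulli w0).real Bn := by
    have h := prodBernoulli_harris w0 (isUpperSet_openConn s x₁) (isUpperSet_openConn b x₁) (hm _) (hm _)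
    have e1 : (prodBernoulli w0).real (openConn s x₁) = 1 - (prodBernoulli w0).real (Set.univ \ S) := by
      rw [← hSc]; exact real_congr_of_sure hG1 c_sx
    have e2 : (prodBernoulli w0).real (openConn b x₁) = (prodBernoulli w0).real Fb := real_congr_of_sure hG1 c_bx
    have e3 : (prodBernoulli w0).real (openConn s x₁ ∩ openConn b x₁) ≤ (prodBernoulli w0).real (openConn s b) :=
      measureReal_mono fun ω hω => SimpleGraph.Reachable.trans hω.1 (SimpleGraph.Reachable.symm hω.2)
    have e4 : (prodBernoulli w0).real (Fb \ S) ≤ (prodBernoulli w0).real Fb := measureReal_mono fun ω hω => hω.1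
    have e5 : (1 - (prodBernoulli w0).real (Set.univ \ S)) * (prodBernoulli w0).real (Fb \ S)
        ≤ (1 - (prodBernoulli w0).real (Set.univ \ S)) * (prodBernoulli w0).real Fb :=
      mul_le_mul_of_nonneg_left e4 (sub_nonneg.2 measureReal_le_one)
    rw [e1, e2] at h
    rw [mb0] at e3
    linarith
  have BrNear' := BrNear
  rw [eA₁, eZb, eDb, eHb] at BrNear'
  have BrFar' := BrFar
  rw [a0, zc0, hz, dc0, hc0] at BrFar'
  -- sign facts
  have hp0 : (0 : ℝ) ≤ w e := (w e).2.1
  have hp1 : (w e : ℝ) ≤ 1 := (w e).2.2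
  -- (6) assemble
  rw [ob (openConn b v \ openConn s v), ob (openConn c v \ openConn s v),
    ob ((openConn b v ∩ openConn c v) \ openConn s v), ob ((openConn b v \ openConn s v) ∩ openConn s c),
    ob ((openConn c v \ openConn s v) ∩ openConn s b), ob (openConn s b), ob (openConn s c),
    db0, db1, dc0, dc1, dbc0, dbc1, xb0, xb1, xc0, xc1, mb0, mb1, mc0, mc1, hW'c, hSc]
  have key := theta_diffBranch_real (w e) ((prodBernoulli w0).real (Set.univ \ W')) ((prodBernoulli w0).real (Set.univ \ S))
    ((prodBernoulli w0).real (Fb \ S)) ((prodBernoulli w0).real ((Bn \ S) \ Fb)) ((prodBernoulli w0).real Bn)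
    ((prodBernoulli w0).real (Rc \ W')) ((prodBernoulli w0).real (Cf \ W')) ((prodBernoulli w0).real Cf)
    hp0 hp1 measureReal_le_one measureReal_nonneg measureReal_nonneg BrNear' BrFar' HarB
  linarith [key]

end IncStar

end Summit.CriticalPhenomena.PercolationContinuityZ3.Theorems
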